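import Summits.BirchSwinnertonDyer.Rank1Residual.Additive.SignedTwistOddLayerGeneration
import Summits.BirchSwinnertonDyer.Rank1Residual.Additive.KobayashiLayerLogDescent
import Summits.BirchSwinnertonDyer.Rank1Residual.Additive.PadicLayerEigenTestElement
import Summits.BirchSwinnertonDyer.Rank1Residual.Additive.KobayashiSignedGenerationOfStab
import HarnessLib

/-!
# WITNESSES at the odd layers: a zero-clause minus point of `W(ℚ_k·ℚ_p)` outside
# `p·W(ℚ_k·ℚ_p) + W(ℚ_{k−1}·ℚ_p)` for every odd `k` — the last mathematical input of brick B3's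
# corank half (cell `b2b-bsdres`, CLASS-CLOSURE lane, class O10 — x1b GEN 40, class lead; file 90)

HONEST FRAMING (cell `b2b-bsdres`, run/shared/lean/b2b/bsd-rank1-residual/, verbatim in every
file): the goal of the cell is to DELETE the COMBINATION-SHAPED residual classes of the
Birch–Swinnerton-Dyer formula for ALL analytic-rank `≤ 1` elliptic curves over `ℚ` — "full BSD
formula for every rank `≤ 1` curve in class `C`" assembled STRICTLY from published theorems — so
that the rank-`≤ 1` remainder becomes exactly the CONSTRUCTION-SHAPED classes, which are TYPED
(missing-input `Prop`s), NOT attempted. This is not "finishing BSD". CLASS-CLOSURE lane: prove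
what is provable now; shrink each hard class to its core with data; no claim beyond stated classes;
research routes on CONSTRUCTION-SHAPED X12 / O10; census / instrument output = EVIDENCE / conjecture
items, NEVER a Literature fact; `RESIDUAL-MAP.md` marks change only by signed lines. THIS FILE:
TOOL THEOREMS ONLY — no definition, no named Literature fact, no `sorry`, axioms standard; nothing
is booked; no label / mark / count / sub-cell moves; (C1_η), (C2_η-GZ), (C3_η) stay typed as filed
(cc-typer-6's pen); nothing about `BSD(W, p)` of any pair is claimed.

## What (binders of n1011-p17's dictionary at `E = ℚ_p`: `Ψ : W(ℚ̄_p) ≃ V(ℚ̄_p)`, `V = C • W^{(c)}`,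
## `K₀ ∋ θ = √c` with `Gal(ℚ̄/K₀) ⊴ Γ_ℚ` of index `≤ p − 1`, `η` the character of `θ`, `κ` a
## `ℤ_p`-extension of `ℚ` with (D0) and `κ(Gal(ℚ̄/K₀)) = ℤ_p`, local tower `Gal(ℚ̄_p/K₀ℚ_n·ℚ_p) =
## Stab(ζ_{p^{n+1}})`, and a good supersingular `ℤ_p`-model `M` of `V` with `a_p(M) = 0`, `p` odd)

**`exists_zeroClause_witness_of_odd`**: for every ODD `k` there is a point
`w ∈ E⁻_W(ℚ_k·ℚ_p) ∩ ker Tr_{k/0}` (the zero-clause minus group `N_k` of file 81) which is NOT of the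
form `p·a + b` with `a ∈ W(ℚ_k·ℚ_p)`, `b ∈ W(ℚ_{k−1}·ℚ_p)` — the hypothesis `hwit` of
`StrictSignedCount.exists_finset_zeroClause_invariant_mod_pow` (file 81) and of the descent
`exists_finset_galoisCohomology_of_zeroClause` (file 82) at the layer `k`, for the TWIST `W`.

Proof (x1b GEN 39 note §3 (i), made elementary): suppose not. File 89 (`hsum` = Prop. 8.12 ii),
kernel, + the η-average): `W_k ⊆ p·W_k + W_{k−1}`. Transport by `Ψ` and the identification
`V(K₀ℚ_k·ℚ_p) = L(k+1)` (points with coordinates in `ℚ_p(ζ_{p^{k+1}})`): the subgroup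
`X = Ψ(W_k) ∩ E₁` of `E_Ω`-points satisfies `X ⊆ p•X + (L(k) ∩ E₁)` (`#Ẽ(𝔽_p) = p + 1` pushes
into `E₁`), so by the LAYER DESCENT of file 87 (uniform contraction of the logarithm, `ℚ_p(ζ_{p^k})`
closed, Prop. 8.7) `X ⊆ L(k)`. But file 88 supplies `y ∈ ℚ_p(ζ_{p^{k+1}}) ∖ ℚ_p(ζ_{p^k})`,
`‖y‖ ≤ 1/4`, on which `Gal(ℚ̄_p/ℚ_k·ℚ_p)` acts through `η` (`y = p^N·ι(θ)·w`), and file 87 a point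
`Q₀ ∈ L(k+1) ∩ E₁` with `Λ Q₀ = y`, which is then `η`-eigen, i.e. `Ψ⁻¹ Q₀ ∈ W_k`; so `Q₀ ∈ X ⊆ L(k)`
and `y = Λ Q₀ ∈ ℚ_p(ζ_{p^k})` — contradiction.

Consequence (not restated here): with files 81/82, for the twist `W` at `E = ℚ_p` the set `S` of
odd layers `≤ n` carries witnesses, so there are `p^{min(m, ⌈n/2⌉)}` distinct classes of
`H¹(ℚ_p, W[p^m])` restricting to Kummer classes of zero-clause minus points: the corank half of
[Kobayashi2003] Thm. 6.2 on the `η`-component WITHOUT Coleman maps, now with NO point-level input.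

References: [Kobayashi2003] S. Kobayashi, Invent. Math. 152 (2003), §2 p. 4, Def. 1.1, Thm. 6.2
(p. 11), Prop. 8.7 (p. 16), Prop. 8.12 (p. 17), §8.4; [SilvermanAEC2009] IV.6.4, VII.2.1/2.2.
-/

noncomputable section

open scoped Classical

open WeierstrassCurve Field

namespace Summit.BirchSwinnertonDyer.Rank1Residual.Additive.SignedTwist

open Literature.NumberTheory.EllipticCurves Literature.NumberTheory.GaloisRepresentations
  Literature.NumberTheory.EllipticCurves.Kobayashi2003 Literature.NumberTheory.EllipticCurves.FormalGroupChart
  Summit.BirchSwinnertonDyer.Rank1Residual.AdditivePotMult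
  Summit.BirchSwinnertonDyer.Rank1Residual.Additive.BallEval
  Summit.BirchSwinnertonDyer.Rank1Residual.Additive.PadicCyclotomicTower
  ZpExtension Field.absoluteGaloisGroup

variable (W : WeierstrassCurve ℚ) (K₀ : Type) [Field K₀] [NumberField K₀] {θ : K₀} {c : ℚ}
  (hθ : θ ∉ Set.range (algebraMap ℚ K₀)) (hc : θ ^ 2 = algebraMap ℚ K₀ c)
  {p : ℕ} [hp : Fact p.Prime] (κ : ZpExtension ℚ p)
  {V : WeierstrassCurve ℚ} [V.IsElliptic] {C : VariableChange ℚ} (hCV : C • W.quadraticTwist c = V)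
  (ι : AlgebraicClosure ℚ →ₐ[ℚ] AlgebraicClosure ℚ_[p])
  (η : absoluteGaloisGroup ℚ →* ℤˣ)
  (hη : ∀ σ : absoluteGaloisGroup ℚ, η σ = 1 ↔ σ • rootInClosure K₀ θ = rootInClosure K₀ θ)

include hθ hc hη in
/-- `Γ_{ℚ_p}` acts on `ι t` (`t = θ ∈ ℚ̄`) through the character `η ∘ res_ι`. [folklore] -/
theorem smul_map_rootInClosure (g : absoluteGaloisGroup ℚ_[p]) :
    g • ι (rootInClosure K₀ θ) = ((η (resGalOfEmb ι g) : ℤˣ) : ℤ) • ι (rootInClosure K₀ θ) := by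
  have hιres : g • ι (rootInClosure K₀ θ) = ι (resGalOfEmb ι g • rootInClosure K₀ θ) := by
    rw [resGalOfEmb_apply]; exact (apply_resGalAuxOfEmb_apply ι g (rootInClosure K₀ θ)).symm
  rw [hιres]
  rcases Int.units_eq_one_or (η (resGalOfEmb ι g)) with h1 | h1
  · rw [(hη _).mp h1, h1, Units.val_one, one_zsmul]
  · rw [(eta_eq_neg_one_iff K₀ hθ hc η hη _).mp h1, h1, Units.val_neg, Units.val_one, neg_one_zsmul,
      map_neg]

include hθ hc hCV hη in
/-- **WITNESSES AT THE ODD LAYERS.** In the setting of the module docstring (`p` odd, `V` with a good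
supersingular `a_p = 0` model `M`, `W` its `θ`-twist, `K₀ ∋ θ` Galois of index `≤ p − 1` carrying the
local cyclotomic tower, (D0), `κ(Gal(ℚ̄/K₀)) = ℤ_p`): for every odd `k` some point of the zero-clause
minus group `E⁻_W(ℚ_k·ℚ_p) ∩ ker Tr_{k/0}` is not in `p·W(ℚ_k·ℚ_p) + W(ℚ_{k−1}·ℚ_p)`.
[cite: Kobayashi2003, §2 p. 4, Def. 1.1, Thm. 6.2 (p. 11), Prop. 8.7 (p. 16), Prop. 8.12 (p. 17)]
[cite: SilvermanAEC2009, IV.6.4] -/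
theorem exists_zeroClause_witness_of_odd
    (hD : ∀ g : absoluteGaloisGroup ℚ, ∃ τ : absoluteGaloisGroup ℚ_[p],
      (resGalOfEmb ι τ)⁻¹ * g ∈ towerTopSubgroup κ K₀)
    (hκ₀ : ∀ x, ∃ g ∈ galRange (K := ℚ) K₀, κ g = x) [(galRange (K := ℚ) K₀).Normal]
    (hidx : (galRange (K := ℚ) K₀).index ≤ p - 1) (hp2 : p ≠ 2)
    (M : WeierstrassCurve ℤ_[p]) [hE : (M.map PadicInt.Coe.ringHom).IsElliptic]
    [hEt : (M.map PadicInt.toZMod).IsElliptic]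
    (htr : Literature.NumberTheory.EllipticCurves.HasseManin.tr (M.map PadicInt.toZMod) = 0)
    (hVM : M.baseChange (AlgebraicClosure ℚ_[p]) = V.baseChange (AlgebraicClosure ℚ_[p]))
    (hU : ∀ n, localSubgroupOfEmb (towerSubgroup κ K₀ n) ι = stab p (n + 1))
    {k : ℕ} (hk : Odd k) :
    ∃ w ∈ signedLocalPointsOfEmb κ ι W (-1) k ⊓ (localTraceOfEmb κ ι W 0 k).ker,
      ¬ ∃ a ∈ localLayerPointsOfEmb κ ι W k, ∃ b ∈ localLayerPointsOfEmb κ ι W (k - 1),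
        w = p • a + b := by
  by_contra hcon
  push Not at hcon
  have hk1 : 1 ≤ k := hk.pos
  -- the model on `Ω = ℚ̄_p` and the coordinatewise action
  have hV : genFibΩ p M = V.baseChange (AlgebraicClosure ℚ_[p]) := (genFibΩ_eq_baseChange M).trans hVM
  haveI hintΩ : (genFibΩ p M).IsIntegral (Valued.v (R := PadicAlgCl p)).integer :=
    isIntegral_genFib_baseChange p M
  set e := toLoc hV with he
  set act : absoluteGaloisGroup ℚ_[p] → (genFibΩ p M).toAffine.Point → (genFibΩ p M).toAffine.Point :=
    fun σ Q => e.symm (σ • e Q) with hact_def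
  have hact0 : ∀ σ, act σ 0 = 0 := fun σ => act_zero hV σ
  have hact : ∀ σ (x y : PadicAlgCl p) (h : (genFibΩ p M).toAffine.Nonsingular x y),
      ∃ h', act σ (Affine.Point.some x y h) = Affine.Point.some (σ • x) (σ • y) h' :=
    fun σ x y h => act_some hV σ x y h
  have he_act : ∀ σ Q, e (act σ Q) = σ • e Q := fun σ Q => by
    simp only [hact_def, AddEquiv.apply_symm_apply]
  set L := fun m : ℕ => subfieldPoints (genFibΩ p M) (layer p m).toSubfield coeffs_mem_layer with hLdef
  set E₁ := kernel (Valued.v (R := PadicAlgCl p)) (genFibΩ p M) with hE₁def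
  have hFix : ∀ n (P : localPoints V ℚ_[p]),
      P ∈ localFixedPointsOfEmb ι V (towerSubgroup κ K₀ n) ↔ e.symm P ∈ L (n + 1) :=
    fun n P => mem_localFixedPointsOfEmb_iff_mem_subfieldPoints ι hV hU n P
  -- Prop. 8.7 on `L(m)`, `m ≥ 1`
  have htorsΩ : ∀ m, 1 ≤ m → ∀ Q ∈ L m, ∀ j : ℕ, p ^ j • Q = 0 → Q = 0 := by
    intro m hm Q hQ j hj
    obtain ⟨m₀, rfl⟩ := Nat.exists_eq_add_of_le' hm
    have hQ' : (e Q : localPoints V ℚ_[p]) ∈ localFixedPointsOfEmb ι V (towerSubgroup κ K₀ m₀) := by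
      rw [hFix]; simpa using hQ
    have h := eq_zero_of_prime_pow_smul_eq_zero_localFixedPointsOfEmb_of_stab ι V (towerSubgroup κ K₀)
      hp2 M (isUnit_Δ_of_isElliptic_toZMod p M) (hasseCoeff_mem_maximalIdeal_of_tr_eq_zero hp2 M htr)
      hVM hU m₀ j (e Q) hQ' (by rw [← map_nsmul, hj, map_zero])
    exact e.injective (by rw [h, map_zero])
  -- `hsum` at layer `k` (Prop. 8.12 ii), kernel) and the divisibility `W_k ⊆ p·W_k + W_{k−1}` (file 89)
  have hsum := localFixedPointsOfEmb_le_sup_towerSigned_of_stab (ι := ι) (W := V)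
    (U := towerSubgroup κ K₀) (M := M) hp2 htr (towerSubgroup_antitone κ K₀) hU hVM k
  have hdiv : ∀ Q ∈ localLayerPointsOfEmb κ ι W k, ∃ a ∈ localLayerPointsOfEmb κ ι W k,
      ∃ b ∈ localLayerPointsOfEmb κ ι W (k - 1), Q = p • a + b := fun Q hQ =>
    exists_eq_smul_add_of_forall_zeroClause W K₀ hθ hc κ hCV ι η hη hD hκ₀ hidx hk hsum hcon hQ
  -- the subgroup `X = Ψ(W_k) ∩ E₁` of `E_Ω`-points
  set Ψ := localTransport W K₀ hθ hc hCV ℚ_[p] ι with hΨ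
  set Wk := localLayerPointsOfEmb κ ι W k with hWk
  set X : AddSubgroup (genFibΩ p M).toAffine.Point :=
    (Wk.map Ψ.toAddMonoidHom).comap e.toAddMonoidHom ⊓ E₁ with hXdef
  have hXmem : ∀ x, x ∈ X ↔ (∃ Q ∈ Wk, Ψ Q = e x) ∧ x ∈ E₁ := fun x => by
    rw [hXdef, AddSubgroup.mem_inf, AddSubgroup.mem_comap, AddSubgroup.mem_map]
    rfl
  -- `Ψ(W_j) ⊆ e(L(j+1))`
  have hΨL : ∀ j, ∀ Q ∈ localLayerPointsOfEmb κ ι W j, e.symm (Ψ Q) ∈ L (j + 1) := fun j Q hQ =>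
    (hFix j (Ψ Q)).mp (localTransport_mem_localFixedPoints_and_eigen W K₀ hθ hc κ hCV ι η hη hQ).1
  have hXL : ∀ x ∈ (X : Set (genFibΩ p M).toAffine.Point), x ∈ L (k + 1) := by
    intro x hx
    obtain ⟨⟨Q, hQ, hQx⟩, -⟩ := (hXmem x).mp hx
    have h := hΨL k Q hQ
    rwa [hQx, AddEquiv.symm_apply_apply] at h
  have hXk : ∀ x ∈ (X : Set (genFibΩ p M).toAffine.Point), x ∈ E₁ := fun x hx => ((hXmem x).mp hx).2
  -- `#Ẽ(𝔽_p) = p + 1` pushes layer points into `E₁`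
  have hsat : ∀ m, ∀ Q ∈ L m, (p + 1) • Q ∈ E₁ := fun m Q hQ => by
    rw [← natCard_point_eq_of_tr_eq_zero (M := M) htr]
    exact card_smul_mem_kernel_of_mem_subfieldPoints M hQ
  -- `X ⊆ p•X + (L(k) ∩ E₁)`
  have hstep : ∀ x ∈ (X : Set (genFibΩ p M).toAffine.Point), ∃ a ∈ (X : Set (genFibΩ p M).toAffine.Point),
      ∃ b ∈ L k ⊓ E₁, x = p • a + b := by
    intro x hx
    obtain ⟨⟨Q, hQ, hQx⟩, hxk⟩ := (hXmem x).mp hx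
    obtain ⟨a, ha, b, hb, hQab⟩ := hdiv Q hQ
    set a₁ := e.symm (Ψ a) with ha₁
    set b₁ := e.symm (Ψ b) with hb₁
    have ha₁L : a₁ ∈ L (k + 1) := hΨL k a ha
    have hb₁L : b₁ ∈ L k := by
      have h := hΨL (k - 1) b hb
      rwa [Nat.sub_add_cancel hk1] at h
    have hxab : x = p • a₁ + b₁ := by
      apply e.injective
      rw [← hQx, hQab, map_add, map_nsmul, map_add, map_nsmul, ha₁, hb₁, AddEquiv.apply_symm_apply,
        AddEquiv.apply_symm_apply]
    refine ⟨(p + 1) • a₁ - x, ?_, (p + 1) • b₁, AddSubgroup.mem_inf.mpr ⟨(L k).nsmul_mem hb₁L _,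
      hsat k b₁ hb₁L⟩, ?_⟩
    · refine (hXmem _).mpr ⟨⟨(p + 1) • a - Q, Wk.sub_mem (Wk.nsmul_mem ha _) hQ, ?_⟩,
        E₁.sub_mem (hsat (k + 1) a₁ ha₁L) hxk⟩
      rw [map_sub, map_nsmul, map_sub, map_nsmul, ← hQx, ha₁, AddEquiv.apply_symm_apply]
    · rw [hxab]
      module
  -- LAYER DESCENT (file 87): `X ⊆ L(k)`
  have hXdesc : ∀ x ∈ (X : Set (genFibΩ p M).toAffine.Point), x ∈ L k := fun x hx =>
    mem_subfieldPoints_of_forall_exists_smul_add act hact0 hact (m := k + 1) (m' := k) (by omega)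
      (by omega) (htorsΩ (k + 1) (by omega)) (X : Set (genFibΩ p M).toAffine.Point) hXL hXk hstep hx
  -- the test element (file 88): `G = Gal(ℚ̄_p/ℚ_k·ℚ_p)`, `u` over `K₀ℚ_{k−1}` with `κ(u) = p^{k−1}`
  set G := localLayerSubgroupOfEmb κ ι k with hGdef
  have hG : IsClosed (G : Set (absoluteGaloisGroup ℚ_[p])) :=
    Subgroup.isClosed_of_isOpen _ ((κ.isOpen_layerSubgroup k).preimage (resGalOfEmb ι).continuous_toFun)
  have hle : stab p (k + 1) ≤ G := by
    rw [← hU k]; exact localSubgroupOfEmb_tower_le_layer K₀ κ ι k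
  obtain ⟨u, huK, hux⟩ := exists_resGalOfEmb_mem_galRange_and_kappa_eq κ K₀ ι hD hκ₀
    (Multiplicative.ofAdd ((p : ℤ_[p]) ^ (k - 1)))
  have hu : u ∈ stab p k := by
    have h : u ∈ localSubgroupOfEmb (towerSubgroup κ K₀ (k - 1)) ι := by
      rw [mem_localSubgroupOfEmb_iff, mem_towerSubgroup_iff, mem_layerSubgroup, hux]
      exact ⟨dvd_rfl, huK⟩
    rw [hU (k - 1), Nat.sub_add_cancel hk1] at h
    exact h
  have huG : u ∉ G := by
    rw [hGdef, mem_localLayerSubgroupOfEmb_iff, hux, toAdd_ofAdd]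
    intro h
    obtain ⟨j, rfl⟩ := Nat.exists_eq_add_of_le' hk1
    rw [Nat.add_sub_cancel, pow_succ] at h
    have h1 : (p : ℤ_[p]) ∣ 1 := by
      have h' : (p : ℤ_[p]) ^ j * p ∣ (p : ℤ_[p]) ^ j * 1 := by rwa [mul_one]
      exact (mul_dvd_mul_iff_left (pow_ne_zero j (PadicInt.irreducible_p (p := p)).ne_zero)).mp h'
    exact (PadicInt.irreducible_p (p := p)).not_isUnit (isUnit_of_dvd_one h1)
  set t : PadicAlgCl p := ι (rootInClosure K₀ θ) with htdef
  have ht0 : t ≠ 0 := (map_ne_zero_iff ι ι.toRingHom.injective).mpr (rootInClosure_ne_zero K₀ hθ)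
  have htχ : ∀ g : absoluteGaloisGroup ℚ_[p], g • t = ((η (resGalOfEmb ι g) : ℤˣ) : ℤ) • t :=
    fun g => smul_map_rootInClosure K₀ hθ hc ι η hη g
  have ht1 : t ∈ layer p 1 := by
    refine (mem_layer_iff_forall_smul_eq t).mpr fun σ hσ => ?_
    have hσ' : σ ∈ localSubgroupOfEmb (towerSubgroup κ K₀ 0) ι := by rw [hU 0]; exact hσ
    have hgal : resGalOfEmb ι σ ∈ galRange (K := ℚ) K₀ :=
      ((mem_towerSubgroup_iff κ K₀ 0 _).mp ((mem_localSubgroupOfEmb_iff _ ι _).mp hσ')).2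
    rw [htχ σ, (hη _).mpr (apply_rootInClosure_of_mem K₀ hgal), Units.val_one, one_zsmul]
  obtain ⟨y, hyL, hy4, hyk, hyχ⟩ := exists_eigen_not_mem_layer hk1 G hG hle hu huG
    (fun g => ((η (resGalOfEmb ι g) : ℤˣ) : ℤ)) ht1 ht0 (fun g _ => htχ g)
  -- the test point (file 87): `Q₀ ∈ L(k+1) ∩ E₁` with `Λ Q₀ = y`, which is `η`-eigen
  obtain ⟨Q₀, hQ₀L, hQ₀k, hΛ⟩ := exists_mem_kernel_ptLogΩ_eq (p := p) (M := M) hyL hy4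
  have hactQ₀ : ∀ g ∈ G, act g Q₀ = ((η (resGalOfEmb ι g) : ℤˣ) : ℤ) • Q₀ := fun g hg =>
    act_eq_zsmul_of_smul_ptLogΩ_eq act hact0 hact (htorsΩ (k + 1) (by omega)) hQ₀L hQ₀k g _
      (by rw [hΛ]; exact hyχ g hg)
  -- `Ψ⁻¹(e Q₀) ∈ W_k`, so `Q₀ ∈ X`
  have hP₀ : Ψ.symm (e Q₀) ∈ Wk := by
    rw [hWk, mem_localLayerPointsOfEmb_iff]
    intro g hg
    apply Ψ.injective
    rw [hΨ, localTransport_smul W K₀ hθ hc hCV ℚ_[p] ι η hη g, AddEquiv.apply_symm_apply, ← he_act,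
      hactQ₀ g hg, map_zsmul, units_smul_units_smul]
  have hQ₀X : Q₀ ∈ (X : Set (genFibΩ p M).toAffine.Point) :=
    (hXmem Q₀).mpr ⟨⟨Ψ.symm (e Q₀), hP₀, AddEquiv.apply_symm_apply _ _⟩, hQ₀k⟩
  -- contradiction: `y = Λ Q₀ ∈ layer k`
  exact hyk (hΛ ▸ ptLogΩ_mem_layer (hXdesc Q₀ hQ₀X) hQ₀k)

end Summit.BirchSwinnertonDyer.Rank1Residual.Additive.SignedTwist

end
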